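import Summits.HodgeConjecture.HodgeConjecture.Theorems.F0P2tLineThetaLiftNeZeroOfArchFixed   -- ★ (N4) `thetaPair_ne_zero_of_archFixed`
import Literature.LinearAlgebra.Matrix.HermitianCongruenceInertia                          -- ★ Sylvester: `exists_re_neg_of_frame_signature_units`, `re_pos_of_frame_posDef_units`
import Literature.AlgebraicGeometry.ShimuraVarieties.UnitaryBallRealPoints                  -- ★ `signatureMatrix_two : signatureMatrix 2 = BallModel.J`
import Literature.NumberTheory.Automorphic.AdelicUnitaryGroup                              -- ★ `embedding_cmConjRingHom`
import Literature.NumberTheory.Automorphic.AdelicUnitaryGroupDatum                         -- ★ `UnitaryGroup.exists_infinitePlace_ne`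
import HarnessLib

/-!
# Crux `H413`, programme P2 — Θ-OCC-GEN road, brick (N5): the SIGN FACTS of the OCC♭-GEN frame (Sylvester) and THE (N)-HALF AT THE FRAME —
# `hN` of ★ `F0P2sThetaOccursInOfArch` from an arch-fixed harmonic vector, with NO sign ∕ place ∕ letter binder left

Cell hodgecm-mathlib (D-0151), FLOOR 0, crux item H413 = stmt-HodgeConjecture-24833; programme P2, sub-line `Cruxes/H413/Lines/F0_P2OccFlatGeneral.lean`
ED. 1 (Θ-OCC-GEN `stub_thetaOccursInGen`, books #173).  Author F0P2-p06 (g8), (N)-half.  `--supports stmt-HodgeConjecture-24833`.  DEF-FREE, theorems only.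

THE POINT.  The (N)-bricks (N0) ★ `ThetaLiftFromLineMajorants`, (N1) ★ `ThetaLiftFromLineL2Continuity`, (N3) ★ `F0P2tLineRallisIdentity`, (N4) ★
`F0P2tLineThetaLiftNeZeroOfArchFixed` take as input the sign facts of the diagonal frame `d_V` through the complex embeddings — `h₁V` (through `ι` all but one
`ι(d_V i)` of one strict sign: signature `(2,1)` up to orientation), `hV` (through every `τ` off the place of `ι` all of one strict sign: definite) — and one `τ` with
`re τ(d_V i) > 0`.  In the OCC♭-GEN frame `(L, ι, H, T, hT : Tᴴ·H^ι·T = J, hpos : H^{τ'} ≻ 0 off ι, g, hg : ḡᵀ·H·g = diag d_V, 2 ≤ [L⁺:ℚ])` these are SYLVESTER'S LAW OF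
INERTIA, a ★ theorem of the tree (★ `Literature.LinearAlgebra.Matrix.exists_re_neg_of_frame_signature_units` ∕ `re_pos_of_frame_posDef_units`, [HornJohnson2013, Thm 4.5.8])
read at the frame: `diag(ι d_V) = Cᴴ J C` (`C = T⁻¹ ι(g)`) has exactly one negative entry; `diag(τ d_V) = ι(g)ᴴ H^τ ι(g) ≻ 0`.  A place off `ι` exists since `[L:ℚ] ≥ 4`
(★ `UnitaryGroup.exists_infinitePlace_ne`).

* `re_pos_dV_of_frame` ∕ `hV_of_frame` — definiteness of `d_V` off the place of `ι`;  `h₁V_of_frame` — signature `(2,1)` of `d_V` at `ι`;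
* **`thetaPair_ne_zero_of_archFixed_frame`** — THE (N)-HALF AT THE OCC♭-GEN FRAME: for the frame data VERBATIM as in ★ `F0P2sThetaOccursInOfArch` (`L ι H T hT`,
  `hpos`, `h2`, `e₁ dV hdV hdV0 g hg μ hμ a χ hρ μW`), every pair `φ₀, φ₁` of archimedean Schwartz vectors one of which is non-zero after `R_{e₁}^∞` and FIXED by
  `U(⟨a⟩)(L⁺ ⊗ ℝ)` under `archWeilRep` at the `μ`-splitting (E), there is a finite `Φ_f` with the theta pair `(x, j) ↦ Θ̃_{R_{e₁}(φ_j ⊗ Φ_f)}(charCM χ̃_χ)(ι_A x)`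
  NON-ZERO — the junction's `hN` — for EVERY finite invariant open-positive `μ_W` on `[U(J_W a)]`.

So Θ-OCC-GEN ⟸ (T-arch)+(E): a harmonic pair with (W)(K)(H) whose `j₀`-th member is `≠ 0` and `U(⟨a⟩)_∞`-fixed ([KonnoKonno2007, Thm 5.4]; [Liu2021, Lem. D.2]: the
Gaussian of the `μ`-admissible line) — the archimedean oscillator computation, and nothing global.
HONEST LABEL: HC_CM is proved only modulo the 2 remaining named inputs (hLiu418, h413) until rung 0 closes; this file asserts nothing of print.

## References
* [HornJohnson2013] R. Horn, C. Johnson, *Matrix Analysis* (2nd ed., 2013), §4.5 Thm 4.5.8 (Sylvester's law of inertia).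
* [Liu2021] Y. Liu, Camb. J. Math. 9 (2021) = arXiv:2102.11518: §4.3; proof of Prop. 4.13 (p. 49 «Conversely»); App. D Lem. D.2.
* [Li1992] J.-S. Li, J. reine angew. Math. 428 (1992), Thm 2.1 (26)–(27) p. 184, §5.  [KonnoKonno2007] T. Konno, K. Konno, Kyushu J. Math. 61 (2007), Thm 5.4.
-/

set_option autoImplicit false
set_option linter.dupNamespace false

noncomputable section

open scoped ComplexConjugate Matrix ComplexOrder TensorProduct SchwartzMap NNReal Classical
open MeasureTheory MeasureTheory.Measure NumberField NumberField.InfinitePlace IsDedekindDomain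
open Literature.NumberTheory.Automorphic Literature.NumberTheory.Automorphic.UnitaryGroup
open Literature.NumberTheory.Automorphic.IdeleClassGroup
open Literature.NumberTheory.Automorphic.Liu2021 Literature.NumberTheory.Automorphic.Liu2021.Def411WeilCarriers
open Literature.NumberTheory.Automorphic.Liu2021.Def411WeilCarriersDoubling
open Literature.NumberTheory.Weil1964 Literature.NumberTheory.Li1992
open Literature.NumberTheory.GelbartRogawski1991 Literature.NumberTheory.GelbartRogawski1991.UnitaryDualPair
open Literature.NumberTheory.GelbartRogawski1991.UnitaryDualPair.WeilCoinv
open Literature.NumberTheory.GaloisRepresentations (HeckeCharacter)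
open Literature.RepresentationTheory.HarrisKudlaSweet1996 (IsSplittingChar)
open Literature.RepresentationTheory.Liu2021
open Literature.RepresentationTheory.CompactGroups (charCM)
open Literature.AlgebraicGeometry.ShimuraVarieties
open Summit.HodgeConjecture.HodgeConjecture.Cruxes.H413

namespace Summit.HodgeConjecture.HodgeConjecture.Cruxes.H413.F0P2tThetaPairNeZeroOfFrame

variable (L : Type) [Field L] [NumberField L] [IsCMField L] (ι : L →+* ℂ) (H : Matrix (Fin 3) (Fin 3) L) (T : GL (Fin 3) ℂ)
  (hT : (T : Matrix (Fin 3) (Fin 3) ℂ)ᴴ * H.map ι * (T : Matrix (Fin 3) (Fin 3) ℂ) = Literature.Geometry.ComplexHyperbolic.BallModel.J)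
  (hpos : ∀ τ' : L →+* ℂ, InfinitePlace.mk τ' ≠ InfinitePlace.mk ι → (H.map τ').PosDef)
  (dV : Fin 3 → L) (hdV : ∀ i, IsCMField.complexConj L (dV i) = dV i) (g : GL (Fin 3) L)
  (hg : ((g : Matrix (Fin 3) (Fin 3) L).map (cmConjRingHom L))ᵀ * H * (g : Matrix (Fin 3) (Fin 3) L) = Matrix.diagonal dV)

/-! ## §1 Sylvester at the frame: the sign facts of `d_V` -/

include hpos hg in
/-- **`d_V` is POSITIVE through every complex embedding off the place of `ι`**: `re τ(d_V i) > 0` (`diag(τ d_V) = ι(g)ᴴ·H^τ·ι(g)`, `H^τ ≻ 0`).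
[cite: HornJohnson2013, §4.5 Thm 4.5.8] [cite: Liu2021, §4.3] -/
theorem re_pos_dV_of_frame (τ : L →+* ℂ) (hτ : InfinitePlace.mk τ ≠ InfinitePlace.mk ι) (i : Fin 3) : 0 < (τ (dV i)).re :=
  Literature.LinearAlgebra.Matrix.re_pos_of_frame_posDef_units τ (cmConjRingHom L) (embedding_cmConjRingHom L τ) H (hpos τ hτ) g dV hg i

include hpos hg in
/-- the `hV` binder of the (N)-bricks at the frame. [cite: HornJohnson2013, §4.5 Thm 4.5.8] -/
theorem hV_of_frame : ∀ τ : L →+* ℂ, InfinitePlace.mk τ ≠ InfinitePlace.mk ι → (∀ i, 0 < (τ (dV i)).re) ∨ ∀ i, (τ (dV i)).re < 0 :=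
  fun τ hτ => Or.inl (re_pos_dV_of_frame L ι H hpos dV g hg τ hτ)

include hT hdV hg in
/-- **`d_V` has signature `(2,1)` through `ι`**: exactly one `re ι(d_V i₀) < 0`, the others `> 0` (`diag(ι d_V) = Cᴴ·J·C`, `C = T⁻¹·ι(g)`; Sylvester).
[cite: HornJohnson2013, §4.5 Thm 4.5.8] [cite: Liu2021, §4.3] -/
theorem exists_re_neg_dV_of_frame : ∃ i₀ : Fin 3, (ι (dV i₀)).re < 0 ∧ ∀ i, i ≠ i₀ → 0 < (ι (dV i)).re := by
  have hT' : (T : Matrix (Fin 3) (Fin 3) ℂ)ᴴ * H.map ι * (T : Matrix (Fin 3) (Fin 3) ℂ) =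
      Matrix.diagonal (fun i => if i = Fin.last 2 then (-1 : ℂ) else 1) := by
    rw [hT, ← UnitaryBallUniformisationDatum.signatureMatrix_two]; rfl
  exact Literature.LinearAlgebra.Matrix.exists_re_neg_of_frame_signature_units ι (cmConjRingHom L) (embedding_cmConjRingHom L ι) H T hT'
    g dV hdV hg

include hT hdV hg in
/-- the `h₁V` binder of the (N)-bricks at the frame. [cite: HornJohnson2013, §4.5 Thm 4.5.8] -/
theorem h₁V_of_frame : ∃ i₀ : Fin 3, (∀ i, i ≠ i₀ → 0 < (ι (dV i)).re) ∨ ∀ i, i ≠ i₀ → (ι (dV i)).re < 0 := by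
  obtain ⟨i₀, -, h⟩ := exists_re_neg_dV_of_frame L ι H T hT dV hdV g hg
  exact ⟨i₀, Or.inl h⟩

/-- `[L:ℚ] ≥ 4` once `[L⁺:ℚ] ≥ 2`. [folklore] -/
private theorem four_le_finrank_of_two_le' (h2 : 2 ≤ Module.finrank ℚ ↥(maximalRealSubfield L)) : 4 ≤ Module.finrank ℚ L := by
  have h := Module.finrank_mul_finrank ℚ ↥(maximalRealSubfield L) L
  rw [Algebra.IsQuadraticExtension.finrank_eq_two ↥(maximalRealSubfield L) L] at h
  omega

/-! ## §2 THE (N)-HALF AT THE OCC♭-GEN FRAME -/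

set_option synthInstance.maxHeartbeats 400000 in
set_option maxHeartbeats 8000000 in
include hT hpos in
/-- **THE (N)-HALF OF Θ-OCC-GEN AT THE FRAME — the junction's `hN`, from an arch-fixed harmonic vector.**  In the OCC♭-GEN frame (signature `(2,1)` at `ι`, definite
elsewhere, `[L⁺:ℚ] ≥ 2`), for every diagonal frame `(e₁, d_V, g)`, conjugate-symplectic `μ`, line `⟨a⟩`, `χ ∈ Chi`, majorants `hρ` (★ (N0)), every finite invariant
open-positive `μ_W` on `[U(J_W a)]`, and every pair `φ₀, φ₁` of archimedean Schwartz vectors with `R_{e₁}^∞ φ_{j₀} ≠ 0` FIXED by `U(⟨a⟩)(L⁺ ⊗ ℝ)` under `archWeilRep` at the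
`μ`-splitting (E): `∃ Φ_f`, the theta pair `(x, j) ↦ Θ̃_{R_{e₁}(φ_j ⊗ Φ_f)}(charCM χ̃_χ)(ι_A x)` is non-zero — ★ (N4) `thetaPair_ne_zero_of_archFixed` with `(h₁V, hV, τ)` from §1.
[cite: Liu2021, proof of Prop. 4.13 (p. 49 «Conversely», l. 2145); App. D §D.1 Step 3] [cite: Li1992, Thm 2.1 (26)–(27) p. 184; §5] [cite: HornJohnson2013, §4.5 Thm 4.5.8] -/
theorem thetaPair_ne_zero_of_archFixed_frame (h2 : 2 ≤ Module.finrank ℚ ↥(maximalRealSubfield L))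
    {n' : ℕ} (e₁ : Fin 3 × Fin 1 ≃ Fin n') (hdV0 : ∀ i, dV i ≠ 0)
    (μH : Literature.NumberTheory.Automorphic.IdeleClassGroup L →ₜ* Circle) (hμ : IsConjugateSymplectic L μH)
    (a : (↥(maximalRealSubfield L))ˣ)
    (hρ : HasThetaMajorants fun
      (p : ↥(UnitaryGroup.adelic (↥(maximalRealSubfield L)) L (IsCMField.complexConj L) 3 (Matrix.diagonal dV)) ×
        ↥(UnitaryGroup.adelic (↥(maximalRealSubfield L)) L (IsCMField.complexConj L) 1 (JW (↥(maximalRealSubfield L)) L a)))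
      (Φ : piSchwartzBruhat (↥(maximalRealSubfield L)) (Fin n')) =>
        pairRep (↥(maximalRealSubfield L)) L (IsCMField.complexConj L) 3 1 e₁ (Matrix.diagonal dV) (JW (↥(maximalRealSubfield L)) L a)
          (chiSplittingLine L e₁ dV hdV hdV0 (toHeckeCharacter L μH) (isUnitary_toHeckeCharacter L μH)
            ((isOscillatorChar_toHeckeCharacter_iff μH).mpr hμ) (TW (↥(maximalRealSubfield L)) a)
            (isUnit_det_TW (↥(maximalRealSubfield L)) a) (JW (↥(maximalRealSubfield L)) L a) (JW_eq (↥(maximalRealSubfield L)) L a))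
          p Φ)
    [CompactSpace (↥(UnitaryGroup.adelic (↥(maximalRealSubfield L)) L (IsCMField.complexConj L) 3 (Matrix.diagonal dV)) ⧸
      (UnitaryGroup.toAdelic (↥(maximalRealSubfield L)) L (IsCMField.complexConj L) 3 (Matrix.diagonal dV)).range)]
    [(UnitaryGroup.toAdelic (↥(maximalRealSubfield L)) L (IsCMField.complexConj L) 1 (JW (↥(maximalRealSubfield L)) L a)).range.Normal]
    [MeasurableSpace (↥(UnitaryGroup.adelic (↥(maximalRealSubfield L)) L (IsCMField.complexConj L) 1 (JW (↥(maximalRealSubfield L)) L a)) ⧸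
      (UnitaryGroup.toAdelic (↥(maximalRealSubfield L)) L (IsCMField.complexConj L) 1 (JW (↥(maximalRealSubfield L)) L a)).range)]
    [BorelSpace (↥(UnitaryGroup.adelic (↥(maximalRealSubfield L)) L (IsCMField.complexConj L) 1 (JW (↥(maximalRealSubfield L)) L a)) ⧸
      (UnitaryGroup.toAdelic (↥(maximalRealSubfield L)) L (IsCMField.complexConj L) 1 (JW (↥(maximalRealSubfield L)) L a)).range)]
    (μW : Measure (↥(UnitaryGroup.adelic (↥(maximalRealSubfield L)) L (IsCMField.complexConj L) 1 (JW (↥(maximalRealSubfield L)) L a)) ⧸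
      (UnitaryGroup.toAdelic (↥(maximalRealSubfield L)) L (IsCMField.complexConj L) 1 (JW (↥(maximalRealSubfield L)) L a)).range))
    [IsFiniteMeasure μW] [μW.IsOpenPosMeasure]
    [SMulInvariantMeasure ↥(UnitaryGroup.adelic (↥(maximalRealSubfield L)) L (IsCMField.complexConj L) 1 (JW (↥(maximalRealSubfield L)) L a))
      (↥(UnitaryGroup.adelic (↥(maximalRealSubfield L)) L (IsCMField.complexConj L) 1 (JW (↥(maximalRealSubfield L)) L a)) ⧸
        (UnitaryGroup.toAdelic (↥(maximalRealSubfield L)) L (IsCMField.complexConj L) 1 (JW (↥(maximalRealSubfield L)) L a)).range) μW]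
    (χ : Chi (↥(maximalRealSubfield L)) L (IsCMField.complexConj L))
    (φ : Fin 2 → 𝓢(((Fin 3 × Fin 1) → NumberField.mixedEmbedding.mixedSpace (↥(maximalRealSubfield L))), ℂ)) (j₀ : Fin 2)
    (hΦ : schwartzReindexCLM (↥(maximalRealSubfield L)) e₁ (φ j₀) ≠ 0)
    (hE : ∀ a' : UnitaryGroup.arch (↥(maximalRealSubfield L)) L (IsCMField.complexConj L) 1 (JW (↥(maximalRealSubfield L)) L a),
      HodgeCM.Model.HypCensus.archWeilRep (↥(maximalRealSubfield L)) L (IsCMField.complexConj L) 3 1 (Matrix.diagonal dV)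
        (JW (↥(maximalRealSubfield L)) L a) (complexConj_imagUnit L) (imagUnit_ne_zero L) (imagUnit_mul_self L) (realDiagonal_isSymm L dV hdV)
        (isSymm_TW (↥(maximalRealSubfield L)) a) (isUnit_det_realDiagonal L dV hdV hdV0) (isUnit_det_TW (↥(maximalRealSubfield L)) a)
        (realDiagonal_map L dV hdV).symm (JW_eq (↥(maximalRealSubfield L)) L a) e₁
        (chiSplittingLine L e₁ dV hdV hdV0 (toHeckeCharacter L μH) (isUnitary_toHeckeCharacter L μH)
          ((isOscillatorChar_toHeckeCharacter_iff μH).mpr hμ) (TW (↥(maximalRealSubfield L)) a)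
          (isUnit_det_TW (↥(maximalRealSubfield L)) a) (JW (↥(maximalRealSubfield L)) L a) (JW_eq (↥(maximalRealSubfield L)) L a))
        (ThetaNonvanishing.proj_apply_eq_toSp (↥(maximalRealSubfield L)) L (IsCMField.complexConj L) 3 1 e₁ (Matrix.diagonal dV)
          (JW (↥(maximalRealSubfield L)) L a) (complexConj_imagUnit L) (imagUnit_ne_zero L) (imagUnit_mul_self L) (realDiagonal_isSymm L dV hdV)
          (isSymm_TW (↥(maximalRealSubfield L)) a) (isUnit_det_realDiagonal L dV hdV hdV0) (isUnit_det_TW (↥(maximalRealSubfield L)) a)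
          (realDiagonal_map L dV hdV).symm (JW_eq (↥(maximalRealSubfield L)) L a)
          (isCompatible_chiSplittingLine L e₁ dV hdV hdV0 (toHeckeCharacter L μH) (isUnitary_toHeckeCharacter L μH)
            ((isOscillatorChar_toHeckeCharacter_iff μH).mpr hμ) (TW (↥(maximalRealSubfield L)) a) (isSymm_TW (↥(maximalRealSubfield L)) a)
            (isUnit_det_TW (↥(maximalRealSubfield L)) a) (JW (↥(maximalRealSubfield L)) L a) (JW_eq (↥(maximalRealSubfield L)) L a)))
        (1, a') (schwartzReindexCLM (↥(maximalRealSubfield L)) e₁ (φ j₀)) = schwartzReindexCLM (↥(maximalRealSubfield L)) e₁ (φ j₀)) :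
    ∃ Φf : FinSB (↥(maximalRealSubfield L)) (Fin 3 × Fin 1),
      (fun (x : (adelicGroupData (↥(maximalRealSubfield L)) L (IsCMField.complexConj L) 3 H).Adelic) (j : Fin 2) =>
        (lineThetaKernelDatum L 3 e₁ dV hdV hdV0 μH hμ a hρ).thetaLiftFun μW
          (piSBReindex (↥(maximalRealSubfield L)) e₁
            (piSchwartzBruhatEquiv (↥(maximalRealSubfield L)) (Fin 3 × Fin 1) (φ j ⊗ₜ[ℂ] Φf)))
          (charCM (chiQuot (↥(maximalRealSubfield L)) L (IsCMField.complexConj L) (Algebra.IsQuadraticExtension.finrank_eq_two _ L)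
            (IsCMField.complexConj_ne_one (K := L)) a χ))
          (cmAdelicFrameTransport L 3 H dV g hg x)) ≠ 0 := by
  have h3 : 3 ≤ n' := by
    have hc := Fintype.card_congr e₁
    simp only [Fintype.card_prod, Fintype.card_fin] at hc
    omega
  obtain ⟨τ, hτ⟩ := UnitaryGroup.exists_infinitePlace_ne L (four_le_finrank_of_two_le' L h2) ι
  exact F0P2tLineThetaLiftNeZeroOfArchFixed.thetaPair_ne_zero_of_archFixed L e₁ dV hdV hdV0 (by norm_num) h3 μH hμ a ι
    (h₁V_of_frame L ι H T hT dV hdV g hg) (hV_of_frame L ι H hpos dV g hg) τ (re_pos_dV_of_frame L ι H hpos dV g hg τ hτ) hρ μW χ H g hg φ j₀ hΦ hE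

end Summit.HodgeConjecture.HodgeConjecture.Cruxes.H413.F0P2tThetaPairNeZeroOfFrame

end
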